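import Literature.NumberTheory.EllipticCurves.TwoDescentRankBounds
import HarnessLib

/-!
# BirchSwinnertonDyer — rank ≥ 2 observatory: the cubic-field `2`-descent map `μ(P) = x(P) − θ`

HONEST FRAMING: per-curve certified theorems and census instruments; no claim on BSD in rank ≥ 2.

First generic file of the KERNEL-2DESC instrument (design `b2b-bsdr2-cert-3/KERNEL-2DESC.md`):
the general `2`-descent map of Cassels, *Lectures on Elliptic Curves* (LMSST 24, 1991), §15,
for a Weierstrass curve `W` over a field `F` and a root `e ∈ K` of its `2`-division cubic in an
extension `φ : F →+* K` (typically `F = ℚ`, `K = ℚ(e)` the cubic field cut out by an irreducible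
`2`-division cubic, `e ∉ F`):

* `mul_mul_addX_sub_eq_sq_map` — the chord-and-tangent identity
  `(x₁ − e)(x₂ − e)(x₃ − e) = (ℓ(e − x₁) + y₁ − y_T)²` in `K` for `P₁ + P₂ = (x₃, *)`, `Pᵢ ∈ E(F)`,
  `y_T = −(a₁e + a₃)/2`: Mathlib's `addPolynomial_slope` mapped to `K` and evaluated at `e`
  (the tree's `TwoDescent.mul_mul_addX_sub_eq_sq` asks for all three roots in `F`; only
  "`(e, y_T)` lies on the curve" is used, and here `e` may live in an extension);
* `muMap W φ e : E(F) → Kˣ/(Kˣ)²`, `(x, y) ↦ x − e`, `O ↦ 1`, and **`muMap_add`**: it is a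
  homomorphism as soon as `e ∉ φ(F)` (LEC §15 Lemma 1, irreducible case); `muHom` packages it as
  `E(F) →+ Additive (Kˣ/(Kˣ)²)`;
* `two_pow_finrank_le_natCard_range` — the counting half of the descent for curves WITHOUT
  rational `2`-torsion: for a finitely generated abelian group `A` and an additive `ψ` with
  `ker ψ ⊆ 2A`, `2 ^ rank_ℤ A ≤ #ψ(A)` (the tree's `pow_finrank_add_two_le_natCard_range` minus its
  two torsion points).

The kernel statement `μ(P) ∈ (Kˣ)² ⇒ P ∈ 2E(F)` (LEC §15 Lemma 2) is the next file. Sorry-free;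
axioms `propext`, `Classical.choice`, `Quot.sound`. References: J. W. S. Cassels, *Lectures on
Elliptic Curves*, LMS Student Texts 24 (1991), §15, Lemmas 1–2; J. H. Silverman, AEC (2009) X.1.
-/

-- single-conjunct summit: `Summit.BirchSwinnertonDyer.BirchSwinnertonDyer.…` repeats the name by design
set_option linter.dupNamespace false

noncomputable section

open scoped Classical

open Polynomial

namespace Summit.BirchSwinnertonDyer.BirchSwinnertonDyer.Rank2Observatory.TwoDescCubic

open WeierstrassCurve WeierstrassCurve.Affine WeierstrassCurve.Affine.Point

/-! ### Counting: `2 ^ rank ≤ #ψ(A)` when `ker ψ ⊆ 2A` -/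

section Counting

variable {A V : Type*} [AddCommGroup A] [AddCommGroup V]

/-- **`2 ^ rank_ℤ A ≤ #ψ(A)`** for a finitely generated abelian group `A` and an additive map `ψ`
whose kernel consists of doubles: `A ↠ (A/A_tors)/2 ≅ (ℤ/2)^r` kills `ker ψ ⊆ 2A`, so it factors
through `A/ker ψ ≅ ψ(A)`. (Silverman AEC VIII.§1 / X.1, `#E/2E = 2^r·#E[2] ≥ 2^r`.) [folklore] -/
theorem two_pow_finrank_le_natCard_range [Module.Finite ℤ A] (ψ : A →+ V)
    (hker : ∀ a, ψ a = 0 → ∃ b, a = 2 • b) [Finite ψ.range] :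
    2 ^ Module.finrank ℤ A ≤ Nat.card ψ.range := by
  set T := AddCommGroup.torsion A with hT
  let π : A →ₗ[ℤ] A ⧸ T := (QuotientAddGroup.mk' T).toIntLinearMap
  have hπ : Function.Surjective π := QuotientAddGroup.mk'_surjective T
  haveI : Module.Finite ℤ (A ⧸ T) := Module.Finite.of_surjective π hπ
  haveI : NoZeroSMulDivisors ℤ (A ⧸ T) := inferInstance
  haveI : Module.Free ℤ (A ⧸ T) := Module.free_of_finite_type_torsion_free'
  have hrank : Module.finrank ℤ (A ⧸ T) = Module.finrank ℤ A := by
    have hker' : LinearMap.ker π ≤ Submodule.torsion ℤ A := by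
      intro x hx
      have hx' : x ∈ T := (QuotientAddGroup.eq_zero_iff x).mp (LinearMap.mem_ker.mp hx)
      rwa [hT, ← Submodule.torsion_int] at hx'
    rw [← (π.quotKerEquivOfSurjective hπ).finrank_eq]
    exact finrank_quotient_eq_of_le_torsion hker'
  let g : A →+ ModN (A ⧸ T) 2 := (ModN.mkQ 2).comp (QuotientAddGroup.mk' T)
  have hg : Function.Surjective g :=
    (Submodule.mkQ_surjective _).comp (QuotientAddGroup.mk'_surjective T)
  have hle : ψ.ker ≤ g.ker := by
    intro a ha
    obtain ⟨b, rfl⟩ := hker a ha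
    rw [AddMonoidHom.mem_ker]
    change ModN.mkQ 2 (QuotientAddGroup.mk' T (2 • b)) = 0
    rw [map_nsmul, ← natCast_zsmul]
    exact (Submodule.Quotient.mk_eq_zero _).mpr ⟨QuotientAddGroup.mk' T b, rfl⟩
  let Φ : A ⧸ ψ.ker →+ ModN (A ⧸ T) 2 := QuotientAddGroup.lift _ g hle
  have hΦ : Function.Surjective Φ := by
    intro y
    obtain ⟨a, rfl⟩ := hg y
    exact ⟨QuotientAddGroup.mk a, QuotientAddGroup.lift_mk _ hle a⟩
  let e : A ⧸ ψ.ker ≃+ ψ.range := QuotientAddGroup.quotientKerEquivRange ψ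
  haveI : Finite (A ⧸ ψ.ker) := Finite.of_equiv _ e.toEquiv.symm
  rw [← Nat.card_congr e.toEquiv]
  have hprod := AddSubgroup.card_eq_card_quotient_mul_card_addSubgroup Φ.ker
  rw [Nat.card_congr (QuotientAddGroup.quotientKerEquivOfSurjective Φ hΦ).toEquiv,
    ModN.natCard_eq, hrank] at hprod
  rw [hprod]
  haveI : Finite Φ.ker := inferInstance
  exact Nat.le_mul_of_pos_right _ Nat.card_pos

/-- `Finset` form used by the per-curve files: if `ψ(A) ⊆ S` for a finite set `S` of classes,
`2 ^ rank_ℤ A ≤ #S`. [folklore] -/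
theorem two_pow_finrank_le_card [Module.Finite ℤ A] (ψ : A →+ V)
    (hker : ∀ a, ψ a = 0 → ∃ b, a = 2 • b) (S : Finset V) (hS : ∀ a, ψ a ∈ S) :
    2 ^ Module.finrank ℤ A ≤ S.card := by
  have hsub : (ψ.range : Set V) ⊆ ↑S := by
    rintro v ⟨a, rfl⟩
    exact hS a
  haveI : Finite ψ.range := (S.finite_toSet.subset hsub).to_subtype
  refine (two_pow_finrank_le_natCard_range ψ hker).trans ?_
  rw [← SetLike.coe_sort_coe, Nat.card_coe_set_eq, ← Set.ncard_coe_finset]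
  exact Set.ncard_le_ncard hsub S.finite_toSet

end Counting

/-! ### The identity behind `μ`: `addPolynomial_slope` mapped to `K` and evaluated at `e` -/

section Identity

variable {F K : Type*} [Field F] [Field K] {W : Affine F}

/-- **Chord-and-tangent identity in an extension.** `φ : F →+* K`, `e ∈ K` a root of the
`2`-division cubic `4X³ + b₂X² + 2b₄X + b₆` of `W` (equivalently `(e, −(a₁e + a₃)/2)` lies on `W`
over `K`), `P₁ = (x₁, y₁)`, `P₂ = (x₂, y₂) ∈ E(F)` with `P₁ ≠ −P₂`, `P₁ + P₂ = (x₃, *)`, `ℓ` the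
slope: `(x₁ − e)(x₂ − e)(x₃ − e) = (ℓ(e − x₁) + y₁ + (a₁e + a₃)/2)²` in `K`. Mathlib's
`addPolynomial_slope` (`W(X, ℓ(X − x₁) + y₁) = −(X − x₁)(X − x₂)(X − x₃)`) mapped by `φ` and
evaluated at `e`. [cite: Cassels1991LecturesEllipticCurves, §15 Lemma 1] -/
theorem mul_mul_addX_sub_eq_sq_map [DecidableEq F] (φ : F →+* K) {e : K}
    (hroot : 4 * e ^ 3 + φ W.b₂ * e ^ 2 + 2 * φ W.b₄ * e + φ W.b₆ = 0) {x₁ x₂ y₁ y₂ : F}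
    (h₁ : W.Equation x₁ y₁) (h₂ : W.Equation x₂ y₂) (hxy : ¬(x₁ = x₂ ∧ y₁ = W.negY x₂ y₂)) :
    4 * ((φ x₁ - e) * (φ x₂ - e) * (φ (W.addX x₁ x₂ (W.slope x₁ x₂ y₁ y₂)) - e)) =
      (2 * (φ (W.slope x₁ x₂ y₁ y₂) * (e - φ x₁) + φ y₁) + (φ W.a₁ * e + φ W.a₃)) ^ 2 := by
  have hp := congrArg (fun p : F[X] => (p.map φ).eval e) (addPolynomial_slope h₁ h₂ hxy)
  rw [← map_addPolynomial, eval_addPolynomial] at hp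
  simp only [Polynomial.map_neg, Polynomial.map_mul, Polynomial.map_sub, Polynomial.map_X,
    Polynomial.map_C, eval_neg, eval_mul, eval_sub, eval_X, eval_C, map_a₁, map_a₂, map_a₃,
    map_a₄, map_a₆] at hp
  simp only [WeierstrassCurve.b₂, WeierstrassCurve.b₄, WeierstrassCurve.b₆, map_add, map_mul,
    map_pow, map_ofNat] at hroot
  linear_combination -4 * hp - hroot

end Identity

/-! ### The map `μ` and its multiplicativity -/

section Mu

variable {F K : Type*} [Field F] [Field K] (W : Affine F) (φ : F →+* K) (e : K)

open Literature.NumberTheory.EllipticCurves WeierstrassCurve.Affine in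
/-- **Cassels' `μ`-map** `E(F) → Kˣ/(Kˣ)²`, `(x, y) ↦ (φ x − e)·(Kˣ)²`, `O ↦ 1`, for a root
`e ∈ K` of the `2`-division cubic (LEC §15: `μ(a, b) = (a − Θ)`, the component of the general
`2`-descent in the field `ℚ[Θ]`). Junk value `1` if `φ x = e` (excluded by `e ∉ φ(F)` in use).
[cite: Cassels1991LecturesEllipticCurves, §15 (definition of μ)] -/
def muMap : W.Point → SqUnits K
  | 0 => 1
  | .some x _ _ => sqClass (φ x - e)

variable {W φ e}

/-- `μ(O) = 1`. [cite: Cassels1991LecturesEllipticCurves, §15] -/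
@[simp] theorem muMap_zero : muMap W φ e 0 = 1 := rfl

/-- `μ(x, y) = (φ x − e)·(Kˣ)²`. [cite: Cassels1991LecturesEllipticCurves, §15] -/
theorem muMap_some {x y : F} (h : W.Nonsingular x y) :
    muMap W φ e (some x y h) = sqClass (φ x - e) := rfl

/-- `μ(−P) = μ(P)` (it only depends on `x`). [folklore] -/
theorem muMap_neg (P : W.Point) : muMap W φ e (-P) = muMap W φ e P := by
  rcases P with _ | ⟨x, y, hP⟩
  · rfl
  · rw [neg_some]; rfl

variable [CharZero K]

/-- **`μ` is a homomorphism** (LEC §15 Lemma 1, irreducible case): if `e ∈ K` is a root of the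
`2`-division cubic of `W` and `e ∉ φ(F)`, then `μ(P + Q) = μ(P)μ(Q)` in `Kˣ/(Kˣ)²` — by the
identity `mul_mul_addX_sub_eq_sq_map` the product `μ(P)μ(Q)μ(P + Q)` is `4⁻¹`·(a square).
[cite: Cassels1991LecturesEllipticCurves, §15 Lemma 1] -/
theorem muMap_add (hroot : 4 * e ^ 3 + φ W.b₂ * e ^ 2 + 2 * φ W.b₄ * e + φ W.b₆ = 0)
    (he : ∀ x : F, φ x ≠ e) (P Q : W.Point) :
    muMap W φ e (P + Q) = muMap W φ e P * muMap W φ e Q := by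
  rcases P with _ | ⟨x₁, y₁, h₁⟩
  · rw [← zero_def, zero_add, muMap_zero, SqUnits.one_mul]
  rcases Q with _ | ⟨x₂, y₂, h₂⟩
  · rw [← zero_def, add_zero, muMap_zero, SqUnits.mul_one]
  have hx₁ : φ x₁ - e ≠ 0 := sub_ne_zero.mpr (he x₁)
  have hx₂ : φ x₂ - e ≠ 0 := sub_ne_zero.mpr (he x₂)
  rw [muMap_some, muMap_some]
  by_cases hxy : x₁ = x₂ ∧ y₁ = W.negY x₂ y₂
  · rw [add_of_Y_eq hxy.1 hxy.2, muMap_zero, hxy.1, ← sqClass_mul hx₂ hx₂, sqClass_mul_self]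
  rw [add_some hxy, muMap_some]
  have hx₃ : φ (W.addX x₁ x₂ (W.slope x₁ x₂ y₁ y₂)) - e ≠ 0 := sub_ne_zero.mpr (he _)
  have key := mul_mul_addX_sub_eq_sq_map φ hroot h₁.1 h₂.1 hxy
  -- `a b c = (z/2)²`
  have key' : (φ x₁ - e) * (φ x₂ - e) * (φ (W.addX x₁ x₂ (W.slope x₁ x₂ y₁ y₂)) - e) =
      ((2 * (φ (W.slope x₁ x₂ y₁ y₂) * (e - φ x₁) + φ y₁) + (φ W.a₁ * e + φ W.a₃)) / 2) ^ 2 := by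
    rw [div_pow, ← key]
    ring
  exact sqClass_eq_mul_of_mul_mul_eq_sq hx₁ hx₂ hx₃ key'

variable (W φ e) in
/-- `μ` as an additive homomorphism `E(F) →+ Additive (Kˣ/(Kˣ)²)` (for the counting lemma
`two_pow_finrank_le_natCard_range`). [cite: Cassels1991LecturesEllipticCurves, §15 Lemma 1] -/
def muHom (hroot : 4 * e ^ 3 + φ W.b₂ * e ^ 2 + 2 * φ W.b₄ * e + φ W.b₆ = 0)
    (he : ∀ x : F, φ x ≠ e) : W.Point →+ Additive (SqUnits K) where
  toFun P := Additive.ofMul (muMap W φ e P)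
  map_zero' := by rw [muMap_zero]; rfl
  map_add' P Q := by rw [muMap_add hroot he, ofMul_mul]

/-- `muHom` is `μ`. [folklore] -/
@[simp] theorem muHom_apply (hroot : 4 * e ^ 3 + φ W.b₂ * e ^ 2 + 2 * φ W.b₄ * e + φ W.b₆ = 0)
    (he : ∀ x : F, φ x ≠ e) (P : W.Point) :
    muHom W φ e hroot he P = Additive.ofMul (muMap W φ e P) := rfl

/-- `μ` kills `2E(F)` (the target has exponent `2`). [folklore] -/
theorem muMap_two_nsmul (hroot : 4 * e ^ 3 + φ W.b₂ * e ^ 2 + 2 * φ W.b₄ * e + φ W.b₆ = 0)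
    (he : ∀ x : F, φ x ≠ e) (P : W.Point) : muMap W φ e (2 • P) = 1 := by
  rw [two_nsmul, muMap_add hroot he, SqUnits.mul_self]

end Mu

end Summit.BirchSwinnertonDyer.BirchSwinnertonDyer.Rank2Observatory.TwoDescCubic

end
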